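/-
COR-CM cell pub-hodgecm2 — TRANSPOSITION surge (COORDINATOR RE-POINT 2026-08-21T12:07:17Z (3) «INTERFACE-FIRST»;
hodge-director/TRANSPOSITION-MAP.md §0 table, row «tr-typer-3 → tr-prover-3»).  Typer seat prover-pub-hodgecm2-tr-typer-3-0,
2026-08-21.  ITEM (iii) of the six-item dictionary of rfwf v3 §4.2 (`summits__hodge-w-rank-four-weil-faces__free__y1__
paper__paper.tex` ll.245–246): «[PerL §3.1, Lemma 3.1] (from morphisms to automorphic forms; Matsushima; wedges as
κ-isotypic products): general (U(2,1) at ι₁, compact factors elsewhere).»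

TAG: **VERBATIM** — reason: PerL §3.1 (PerL v5 tex ll.219–257) is stated for the unitary group of a hermitian 3-space of
signature (2,1),(3,0)^{d−1} over an arbitrary CM field of degree ≥ 4 and never mentions the one-form types; the stage-1
declarations below are typed over `{L : CMField} {ι₁} (V : HermSpace3 L ι₁) (Γ : Level V)` with no degree / `IsPerLTypes` /
`perlSign` token, and the stage-1 CONSTRUCTIONS `Model.embOf` / `Model.coverOf` are field-generic terms.

Stage-1 declarations this item generalises (package root `run/shared/lean/pub/pub-hodgecm/lean/HodgeCMPerL/`):
* `HodgeCM.Universe.ThetaRealisation` fields `HG` / `Λ` / `cover` / `Λ_cover` / `level_inf` / `inner_Λ`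
  (`HodgeCM/Automorphic/Realisation.lean`:107 / :124 / :147 / :149 / :152 / :154);
* the two PRINT facts on the posited datum `emb`: `ThetaModel.Fact_embCover` (`HodgeCM/Automorphic/ThetaFacts.lean`:109–112),
  `ThetaModel.Fact_innerEmb` (:124–129);
* their model-side TERMS: `Model.embOf` (`HodgeCM/Model/EmbInstance.lean`:307, Matsushima / adelic lift, every `L, ι₁, V, Γ`),
  `Model.coverOf` (`HodgeCM/Model/CoverInstance.lean`:168), and the C2 discharge `innerEmbAt_of_sides`
  (`HodgeCM/Model/InnerEmbReduction.lean`:100) / `innerEmbAt_of_bettiSide` (`HodgeCM/Model/EmbPetersson.lean`:123);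
* the LEVEL-MEETING replacement of `Fact_embCover` in stage 1's end state of record: `ThetaRealisation₁.Λ_meet`
  (`HodgeCM/Model/EndStateLevelMeet.lean`, hazard C1 ll.12–22) and `ThetaRealisation₂` (`HodgeCM/Model/EndStateMeet.lean`).
Tree side (stage 2): the fields `HG` (:69), `emb` (:73), `cover` (:88), `emb_cover` (:90), `inner_emb` (:93) of the socket
`Universe.FaceThetaDatum` (`Summits/HodgeConjecture/CorCM/B01/ThetaRealisationSocket.lean`:66–97).

Nothing is asserted: two Type-valued records, four `def … : Prop` binders, junction and monotonicity theorems.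
FRAMING (COORDINATOR RULING 2026-08-21T11:55:35Z): HC_CM is NOT proved; this file proves no instance of any binder.
-/
import Summits.HodgeConjecture.CorCM.B01.ThetaRealisationSocket
import HarnessLib

/-!
# Transposition item (iii): from morphisms to automorphic forms — Matsushima, Petersson = cup, change of level

The automorphic dictionary PerL §3.1 uses (PerL v5, `summits__hodge-w-picard-modular-quadrilinear-period-galois-closure__
free__y1__paper__paper.tex`): Lemma 3.1 `lem:Krat` (ll.223–237: morphisms `P → B_t` ↔ one-forms with `Q ≠ 0`, Albanese —
on the tree this is the engine's multilinear expansion `Universe.periodNV_of_period_ne_zero`, `B01/PeriodExpansion.lean`:112,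
already PROVED); the Matsushima paragraph (ll.238–246: holomorphic `p`-forms on `S(K_f)` = `(C^∞(G_U(L₀)\G_U(𝔸)/K_f) ⊗ ∧ᵖτ)^{K_∞}`
killed by `𝔭₋`, wedge = product of functions, `⟨η, η'⟩ = c_{K_f} ∫_{[G_U]} η \bar η'`, `c_{K_f} > 0`; Borel–Wallach VII 3.2
pp.142–143, 3.5, 3.6 p.145, II 2.2(3) p.33); eq. (Qaut) (ll.247–256: wedges as `∧²𝔭₊`-isotypic products).  What the CRUX
consumes of it is exactly the (iii)-fields of the tree socket `Universe.FaceThetaDatum`; this file types them TWICE: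

* `Transposition.AutomorphicDictionary U ι₁ V` — SOCKET-VERBATIM: `HG`, `emb`, `cover`, `emb_cover`, `inner_emb` with the
  types of `ThetaRealisationSocket.lean`:69–95 (item (i) bookkeeping `cover`/`emb_cover` included, because `emb_cover` mentions
  both).  Junctions: `AutomorphicDictionary.toFaceThetaDatum` (dictionary + the theta fields of items (ii)(v)(vi) ⇒ the socket
  datum) and `AutomorphicDictionary.ofFaceThetaDatum` (forgetful).  V-UNIFORM and TYPE-FREE: no `K`, `Ψ`, `σ`, `Face`.
* `Transposition.AutomorphicMeeting U ι₁ V` — the MEETING FORM stage 1 actually delivers (hazard C1, `EndStateLevelMeet.lean`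
  ll.12–22: the tower identity `emb Γ' (cover^* η) = emb Γ η` is FALSE for the extension-by-zero adelic Matsushima embedding
  `Model.embOf` as soon as the principal `K_Γ`-piece of `[G_U]` splits into `r(K_Γ, K_{Γ'}) > 1` `K_{Γ'}`-pieces; stage 1's E
  term of record carries level-MEETING instead): `HG`, `emb`, `inner_emb`, and `levelMeet` — non-orthogonality of embedded
  `(2,0)`-classes at two levels is witnessed at ONE level through pull-backs along two MORPHISMS of the tower (coverings and
  Hecke translates in the model; `U_Ψ` is stable under every such pull-back, `Universe.pullC_mem_Uiso`, `B01/PeriodExpansion.lean`:52).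
  `AutomorphicDictionary.toMeeting`: the socket form implies the meeting form (common level `Γ₁ ⊓ Γ₂`, `emb_cover`).
  `Transposition.periodNV_of_meeting`: THE ENGINE over the meeting form (port of `Universe.periodNV_of_faceThetaDatum`,
  `ThetaRealisationSocket.lean`:106, Step 3 replaced by `levelMeet`), with the theta-side inputs of items (ii)(v)(vi) as explicit
  binders in their CONSUMED (meeting) quantifier form — so a prover of item (iii) may target EITHER record.

Displayed binders (binder style of stage 1's `StubTree/Inputs.lean`; asserted by no one): `AutomorphicDictionaryExists U`
(GENERAL: every CM `L` with `4 ≤ [L:ℚ]`, every `ι₁`, every `V` — PerL's «general», tex l.228 of rfwf), `FaceAutomorphicDictionary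
Exists U` (FACE SCOPE: Galois CM `F`, `6 ≤ [F:ℚ]`, every `ι₁`, every `V` — what `RealisationExistsFace∃` =
`Universe.FaceThetaDataExists` of `Transposition/Assembly.lean` consumes at its chosen `(ι₁, V)`; ∀V costs nothing here because
item (iii) is V-uniform, RE-POINT (1)), and the two `…MeetingExists` analogues; general ⇒ face, dictionary ⇒ meeting.

Deliberately NOT here: the one-form level of the dictionary (`U_t ↔ π[𝔭₊]`, PerL Prop 2.3 — item (ii)); theta one-forms,
`Theta_sub`, the line field, the coupling / isolation (items (v)(vi)); any construction on the model universe (tr-prover-3: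
tree inputs `Literature/AlgebraicGeometry/ShimuraVarieties/UnitaryBallAdelicLift.lean`, `…AdelicLiftPetersson.lean`,
`…LevelCovering.lean`, `HodgeTheory/HodgeModelTopFormOfClass.lean`, `Literature/NumberTheory/Automorphic/LevelOrbitMeeting.lean`,
`CorCM/B01/LevelCovering.lean`, `CorCM/B01/HeckeTranslation.lean`; stage-1 terms to port: `HodgeCM/Model/EmbInstance.lean`,
`CoverInstance.lean`, `EmbPetersson.lean`, `InnerEmbReduction.lean`).
-/

noncomputable section

open scoped TensorProduct InnerProductSpace

namespace Summit.HodgeConjecture.CorCM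

namespace Transposition

open Literature.AlgebraicGeometry.Motives (CMType HodgeStructure)
open Literature.AlgebraicGeometry.Motives.HodgeStructure (conj)

/-! ## 1. Item (iii), socket-verbatim form -/

/-- **Item (iii) — the automorphic dictionary of the tower `(P_Γ)_Γ` of `(L, ι₁, V)`, SOCKET-VERBATIM form** (rfwf v3 §4.2
(iii), tex ll.245–246; PerL v5 §3.1, tex ll.238–257): an inner-product space `HG` («`L²([G_U])` with the Petersson product»,
PerL l.244), a linear map `emb Γ : H²(P_Γ, ℂ) → HG` at every level (Matsushima, PerL ll.238–245; Borel–Wallach VII Thm 3.2),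
the level coverings `cover` with the tower identity `emb_cover`, and «Petersson = cup pairing on `F²H²`, one non-zero constant
per level» `inner_emb` (Borel–Wallach VII 3.1/3.5/3.6, II 2.2(3); PerL l.244 `c_{K_f} > 0`).  Field types = the fields
`HG`/`emb`/`cover`/`emb_cover`/`inner_emb` of `Universe.FaceThetaDatum` (`B01/ThetaRealisationSocket.lean`:69/73/88/90/93)
VERBATIM; generalises stage 1's `ThetaRealisation.HG/Λ/cover/Λ_cover/inner_Λ` (`HodgeCM/Automorphic/Realisation.lean`
:107/124/147/149/154) and `ThetaModel.Fact_embCover/Fact_innerEmb` (`HodgeCM/Automorphic/ThetaFacts.lean`:109/124).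
TYPE-FREE (no `K, Ψ, σ`) and V-UNIFORM.  CAVEAT (stage-1 hazard C1, `HodgeCM/Model/EndStateLevelMeet.lean` ll.12–22):
`emb_cover` holds for an index-normalised classical Petersson model but NOT for the extension-by-zero adelic embedding
`Model.embOf`; see `AutomorphicMeeting` for the form stage 1's E term carries.  DATA, asserted by no one. [folklore] -/
structure AutomorphicDictionary (U : Universe) {L : CMField} (ι₁ : L →+* ℂ) (V : HermSpace3 L ι₁) : Type 1 where
  /-- `L²([G_U])` (or any model of it) with the Petersson inner product (PerL tex l.244) -/
  HG : Type
  [instNACG : NormedAddCommGroup HG]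
  [instIPS : InnerProductSpace ℂ HG]
  /-- Matsushima: degree-two classes of `P_Γ` as elements of `HG` (PerL tex ll.238–245; BW VII Thm 3.2) -/
  emb : ∀ Γ : Level V, U.CohC (U.pms L ι₁ V Γ) 2 →ₗ[ℂ] HG
  /-- the level covering `P_{Γ'} → P_Γ` for `Γ' ≤ Γ` (`K`-order of `Level`) — item (i) bookkeeping -/
  cover : ∀ (Γ Γ' : Level V), Γ' ≤ Γ → U.Mor (U.pms L ι₁ V Γ') (U.pms L ι₁ V Γ)
  /-- tower identity: the `HG`-image of a class is unchanged by pull-back along a level covering (stage-1 `Fact_embCover`) -/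
  emb_cover : ∀ (Γ Γ' : Level V) (h : Γ' ≤ Γ) (x : U.CohC (U.pms L ι₁ V Γ) 2),
    emb Γ' (U.pullC (cover Γ Γ' h) 2 x) = emb Γ x
  /-- Petersson pairing = cup pairing on `F²H²(P_Γ)`, up to a non-zero constant per level (stage-1 `Fact_innerEmb`) -/
  inner_emb : ∀ Γ : Level V, ∃ c : ℂ, c ≠ 0 ∧ ∀ x y : U.CohC (U.pms L ι₁ V Γ) 2,
    x ∈ (U.hodge (U.pms L ι₁ V Γ) 2).F 2 → y ∈ (U.hodge (U.pms L ι₁ V Γ) 2).F 2 →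
      ⟪emb Γ y, emb Γ x⟫_ℂ = c * U.trC (U.pms L ι₁ V Γ) 4 (U.cup2C (U.pms L ι₁ V Γ) 2 x (conj y))

attribute [instance] AutomorphicDictionary.instNACG AutomorphicDictionary.instIPS

namespace AutomorphicDictionary

variable {U : Universe} {L : CMField} {ι₁ : L →+* ℂ} {V : HermSpace3 L ι₁}

/-- **Junction, forgetful direction**: a socket datum `FaceThetaDatum` carries an automorphic dictionary (its fields
`HG`/`emb`/`cover`/`emb_cover`/`inner_emb`, `B01/ThetaRealisationSocket.lean`:69–95). [folklore] -/
def ofFaceThetaDatum {K : CMField} {Ψ : Fin 4 → CMType K} {σ : K →+* ℂ} (R : U.FaceThetaDatum ι₁ V K Ψ σ) :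
    AutomorphicDictionary U ι₁ V where
  HG := R.HG
  emb := R.emb
  cover := R.cover
  emb_cover := R.emb_cover
  inner_emb := R.inner_emb

/-- **Junction, assembling direction**: an automorphic dictionary (item (iii)) together with the theta-side fields stated over
its `HG`/`emb` — theta one-form sets and their typing `Theta ⊆ U_Ψ` (items (ii)/(vi)), the line field (item (vi), PerL Prop 4.3)
and the coupling (item (v), PerL Thm 3.7 + Lemma 3.5) — IS a socket datum `U.FaceThetaDatum ι₁ V K Ψ σ`
(`B01/ThetaRealisationSocket.lean`:66); field order and types verbatim. [folklore] -/
def toFaceThetaDatum (D : AutomorphicDictionary U ι₁ V) {K : CMField} {Ψ : Fin 4 → CMType K} {σ : K →+* ℂ}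
    (Theta : Fin 4 → ∀ Γ : Level V, Set (U.CohC (U.pms L ι₁ V Γ) 1))
    (Theta_sub : ∀ (i : Fin 4) (Γ : Level V), Theta i Γ ⊆ U.Uiso Γ K (Ψ i) σ)
    (lineField : ∃ (Γ : Level V), ∃ ω₁ ∈ Theta 0 Γ, ∃ ω₂ ∈ Theta 1 Γ,
      D.emb Γ (U.cup2C (U.pms L ι₁ V Γ) 1 ω₁ ω₂) ≠ 0)
    (coupling : ∀ (Γ : Level V) (ω₁ ω₂ : U.CohC (U.pms L ι₁ V Γ) 1), ω₁ ∈ Theta 0 Γ → ω₂ ∈ Theta 1 Γ →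
      D.emb Γ (U.cup2C (U.pms L ι₁ V Γ) 1 ω₁ ω₂) ∈ (Submodule.span ℂ
        {x : D.HG | ∃ (Γ' : Level V), ∃ ω₃ ∈ Theta 2 Γ', ∃ ω₄ ∈ Theta 3 Γ',
          x = D.emb Γ' (U.cup2C (U.pms L ι₁ V Γ') 1 ω₃ ω₄)}).topologicalClosure) :
    U.FaceThetaDatum ι₁ V K Ψ σ where
  HG := D.HG
  emb := D.emb
  Theta := Theta
  Theta_sub := Theta_sub
  lineField := lineField
  coupling := coupling
  cover := D.cover
  emb_cover := D.emb_cover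
  inner_emb := D.inner_emb

/-- Round trip: the dictionary of the assembled socket datum is the dictionary one started from. [folklore] -/
theorem ofFaceThetaDatum_toFaceThetaDatum (D : AutomorphicDictionary U ι₁ V) {K : CMField} {Ψ : Fin 4 → CMType K}
    {σ : K →+* ℂ} (Theta : Fin 4 → ∀ Γ : Level V, Set (U.CohC (U.pms L ι₁ V Γ) 1))
    (Theta_sub : ∀ (i : Fin 4) (Γ : Level V), Theta i Γ ⊆ U.Uiso Γ K (Ψ i) σ)
    (lineField : ∃ (Γ : Level V), ∃ ω₁ ∈ Theta 0 Γ, ∃ ω₂ ∈ Theta 1 Γ,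
      D.emb Γ (U.cup2C (U.pms L ι₁ V Γ) 1 ω₁ ω₂) ≠ 0)
    (coupling : ∀ (Γ : Level V) (ω₁ ω₂ : U.CohC (U.pms L ι₁ V Γ) 1), ω₁ ∈ Theta 0 Γ → ω₂ ∈ Theta 1 Γ →
      D.emb Γ (U.cup2C (U.pms L ι₁ V Γ) 1 ω₁ ω₂) ∈ (Submodule.span ℂ
        {x : D.HG | ∃ (Γ' : Level V), ∃ ω₃ ∈ Theta 2 Γ', ∃ ω₄ ∈ Theta 3 Γ',
          x = D.emb Γ' (U.cup2C (U.pms L ι₁ V Γ') 1 ω₃ ω₄)}).topologicalClosure) :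
    ofFaceThetaDatum (D.toFaceThetaDatum Theta Theta_sub lineField coupling) = D := by
  cases D
  rfl

end AutomorphicDictionary

/-! ## 2. Item (iii), meeting form (what stage 1's E term of record carries) -/

/-- **Item (iii) — MEETING FORM** (the quantifiers PerL's proof of Thm 4.4 CONSUMES of §3.1, and the form stage 1's end state
of record carries after hazard C1: `HodgeCM/Model/EndStateLevelMeet.lean` ll.12–60 `ThetaRealisation₁.Λ_meet`,
`HodgeCM/Model/EndStateMeet.lean` `ThetaRealisation₂`): `HG`, `emb`, `inner_emb` as in `AutomorphicDictionary`, and instead of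
`cover`/`emb_cover` the single statement **`levelMeet`**: if the `HG`-images of two `F²H²`-classes `x` (level `Γ₁`) and `y`
(level `Γ₂`) are not orthogonal, then at SOME level `Γ` there are MORPHISMS `f : P_Γ → P_{Γ₁}`, `g : P_Γ → P_{Γ₂}` of the universe
(level coverings and Hecke translates in the model — tree `CorCM/B01/LevelCovering.lean`, `CorCM/B01/HeckeTranslation.lean`) with
`⟪emb Γ (g^* y), emb Γ (f^* x)⟫ ≠ 0`.  This is what Step 3 («pass to a common level», PerL tex ll.375–378) of the engine
`Universe.periodNV_of_faceThetaDatum` (`B01/ThetaRealisationSocket.lean`:117–135) uses of `cover`/`emb_cover`, and it is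
dischargeable for the extension-by-zero adelic embedding `Model.embOf` (stage-1 roadmap, `EndStateLevelMeet.lean` ll.62–80:
piece decomposition + one unimodular substitution; tree, all PROVED: `Literature/NumberTheory/Automorphic/LevelOrbitMeeting.lean`
— `LevelOrbit.exists_mem_inner_translateLp_ne_zero` :391, `pieceLiftLp_eq_sum_translate_levelCover` :253 — with
`LevelOrbitMeetingProjection(Split).lean`, `LevelOrbitSubpiecesMeasure.lean`).  TYPE-FREE, V-UNIFORM; DATA, asserted by no one.
[folklore] -/
structure AutomorphicMeeting (U : Universe) {L : CMField} (ι₁ : L →+* ℂ) (V : HermSpace3 L ι₁) : Type 1 where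
  /-- `L²([G_U])` (or any model of it) with the Petersson inner product -/
  HG : Type
  [instNACG : NormedAddCommGroup HG]
  [instIPS : InnerProductSpace ℂ HG]
  /-- Matsushima: degree-two classes of `P_Γ` as elements of `HG` -/
  emb : ∀ Γ : Level V, U.CohC (U.pms L ι₁ V Γ) 2 →ₗ[ℂ] HG
  /-- Petersson pairing = cup pairing on `F²H²(P_Γ)`, up to a non-zero constant per level (stage-1 C2 `InnerEmbAt`,
  discharged for `Model.embOf` by `innerEmbAt_of_sides`, `HodgeCM/Model/InnerEmbReduction.lean`:100) -/
  inner_emb : ∀ Γ : Level V, ∃ c : ℂ, c ≠ 0 ∧ ∀ x y : U.CohC (U.pms L ι₁ V Γ) 2,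
    x ∈ (U.hodge (U.pms L ι₁ V Γ) 2).F 2 → y ∈ (U.hodge (U.pms L ι₁ V Γ) 2).F 2 →
      ⟪emb Γ y, emb Γ x⟫_ℂ = c * U.trC (U.pms L ι₁ V Γ) 4 (U.cup2C (U.pms L ι₁ V Γ) 2 x (conj y))
  /-- LEVEL-MEETING (stage-1 E3 C1-replacement, morphism form): non-orthogonality of embedded `(2,0)`-classes at two levels
  is witnessed at one level through pull-backs along two morphisms of the tower -/
  levelMeet : ∀ (Γ₁ Γ₂ : Level V) (x : U.CohC (U.pms L ι₁ V Γ₁) 2) (y : U.CohC (U.pms L ι₁ V Γ₂) 2),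
    x ∈ (U.hodge (U.pms L ι₁ V Γ₁) 2).F 2 → y ∈ (U.hodge (U.pms L ι₁ V Γ₂) 2).F 2 →
    ⟪emb Γ₂ y, emb Γ₁ x⟫_ℂ ≠ 0 →
      ∃ (Γ : Level V) (f : U.Mor (U.pms L ι₁ V Γ) (U.pms L ι₁ V Γ₁)) (g : U.Mor (U.pms L ι₁ V Γ) (U.pms L ι₁ V Γ₂)),
        ⟪emb Γ (U.pullC g 2 y), emb Γ (U.pullC f 2 x)⟫_ℂ ≠ 0

attribute [instance] AutomorphicMeeting.instNACG AutomorphicMeeting.instIPS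

namespace AutomorphicDictionary

variable {U : Universe} {L : CMField} {ι₁ : L →+* ℂ} {V : HermSpace3 L ι₁}

/-- **MONOTONICITY: the socket-verbatim dictionary gives the meeting form** — `levelMeet` from `cover`/`emb_cover` at the
common level `Γ₁ ⊓ Γ₂` (`Level.exists_le_le`), the inner product being UNCHANGED (this is Step 3 of
`Universe.periodNV_of_faceThetaDatum` for degree-two classes; no `Fact_…` needed). [folklore] -/
def toMeeting (D : AutomorphicDictionary U ι₁ V) : AutomorphicMeeting U ι₁ V where
  HG := D.HG
  emb := D.emb
  inner_emb := D.inner_emb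
  levelMeet Γ₁ Γ₂ x y _ _ h := by
    obtain ⟨Γ, h₁, h₂⟩ := Level.exists_le_le Γ₁ Γ₂
    refine ⟨Γ, D.cover Γ₁ Γ h₁, D.cover Γ₂ Γ h₂, ?_⟩
    rw [D.emb_cover Γ₁ Γ h₁ x, D.emb_cover Γ₂ Γ h₂ y]
    exact h

/-- The meeting form of a dictionary has the same `HG`. [folklore] -/
@[simp] theorem toMeeting_HG (D : AutomorphicDictionary U ι₁ V) : D.toMeeting.HG = D.HG := rfl

/-- The meeting form of a dictionary has the same `emb`. [folklore] -/
@[simp] theorem toMeeting_emb (D : AutomorphicDictionary U ι₁ V) : D.toMeeting.emb = D.emb := rfl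

end AutomorphicDictionary

/-! ## 3. The engine over the meeting form (what the crux consumes of item (iii)) -/

/-- **THE ENGINE over the meeting form** (port of `Universe.periodNV_of_faceThetaDatum`, `B01/ThetaRealisationSocket.lean`:106,
Steps 1–5, with Step 3 «common level» replaced by `levelMeet`): given an `AutomorphicMeeting` of `(L, ι₁, V)` and, over its
`emb`, the theta-side inputs of items (ii)(v)(vi) in their CONSUMED quantifier form — theta one-form sets typed by
`Theta ⊆ U_Ψ` (items (ii)/(vi): [Y1neg] Thm 8.1(a) / [Liu 2021, Thm 4.18]), a theta (12)-wedge with non-zero `HG`-image at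
SOME level (item (vi), PerL Prop 4.3), and MEETING-coupling: a theta (12)-wedge-function with non-zero image is not orthogonal
to every theta (34)-wedge-function (item (v), PerL Thm 3.7 + Lemma 3.5 as consumed; implied by the socket's closed-span field
`coupling`, see `couplingMeet_of_coupling`) — the period non-vanishing `U.PeriodNV ι₁ V K Ψ σ`.  Uses the universe facts
`Fact_pull_comp` (`U_Ψ` stable under pull-back along ANY morphism, `Universe.pullC_mem_Uiso`), `Fact_pull_cup`, `Fact_pull_hodge`,
`Fact_cup2_hodge` only — the same four as the socket engine, all tree theorems on the model universe
(`Model/PerLConeFacts.lean`). [folklore] -/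
theorem periodNV_of_meeting {U : Universe} (hc : U.Fact_pull_comp) (hH : U.Fact_pull_hodge) (hcup2 : U.Fact_cup2_hodge)
    (hpc : U.Fact_pull_cup) {L : CMField} {ι₁ : L →+* ℂ} {V : HermSpace3 L ι₁} {K : CMField} {Ψ : Fin 4 → CMType K}
    {σ : K →+* ℂ} (M : AutomorphicMeeting U ι₁ V)
    (Theta : Fin 4 → ∀ Γ : Level V, Set (U.CohC (U.pms L ι₁ V Γ) 1))
    (Theta_sub : ∀ (i : Fin 4) (Γ : Level V), Theta i Γ ⊆ U.Uiso Γ K (Ψ i) σ)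
    (lineField : ∃ (Γ : Level V), ∃ ω₁ ∈ Theta 0 Γ, ∃ ω₂ ∈ Theta 1 Γ,
      M.emb Γ (U.cup2C (U.pms L ι₁ V Γ) 1 ω₁ ω₂) ≠ 0)
    (couplingMeet : ∀ (Γ : Level V) (ω₁ ω₂ : U.CohC (U.pms L ι₁ V Γ) 1), ω₁ ∈ Theta 0 Γ → ω₂ ∈ Theta 1 Γ →
      M.emb Γ (U.cup2C (U.pms L ι₁ V Γ) 1 ω₁ ω₂) ≠ 0 →
        ∃ (Γ' : Level V), ∃ ω₃ ∈ Theta 2 Γ', ∃ ω₄ ∈ Theta 3 Γ',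
          ⟪M.emb Γ' (U.cup2C (U.pms L ι₁ V Γ') 1 ω₃ ω₄), M.emb Γ (U.cup2C (U.pms L ι₁ V Γ) 1 ω₁ ω₂)⟫_ℂ ≠ 0) :
    U.PeriodNV ι₁ V K Ψ σ := by
  classical
  -- Step 1: a theta (12)-wedge with non-zero image, at some level Γ₁
  obtain ⟨Γ₁, ω₁, hω₁, ω₂, hω₂, hv⟩ := lineField
  -- Step 2: it pairs non-trivially with one theta (34)-wedge-function, at some level Γ₂
  obtain ⟨Γ₂, ω₃, hω₃, ω₄, hω₄, hu⟩ := couplingMeet Γ₁ ω₁ ω₂ hω₁ hω₂ hv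
  -- Step 3: LEVEL-MEETING — one level Γ and two morphisms f : P_Γ → P_Γ₁, g : P_Γ → P_Γ₂
  have hx : U.cup2C (U.pms L ι₁ V Γ₁) 1 ω₁ ω₂ ∈ (U.hodge (U.pms L ι₁ V Γ₁) (1 + 1)).F (1 + 1) :=
    Universe.cup2C_mem_F_two_of_Uiso hH hcup2 Γ₁ K (Ψ 0) (Ψ 1) σ (Theta_sub 0 Γ₁ hω₁) (Theta_sub 1 Γ₁ hω₂)
  have hy : U.cup2C (U.pms L ι₁ V Γ₂) 1 ω₃ ω₄ ∈ (U.hodge (U.pms L ι₁ V Γ₂) (1 + 1)).F (1 + 1) :=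
    Universe.cup2C_mem_F_two_of_Uiso hH hcup2 Γ₂ K (Ψ 2) (Ψ 3) σ (Theta_sub 2 Γ₂ hω₃) (Theta_sub 3 Γ₂ hω₄)
  obtain ⟨Γ, f, g, hfg⟩ := M.levelMeet Γ₁ Γ₂ _ _ hx hy hu
  let a := U.pullC f 1 ω₁
  let b := U.pullC f 1 ω₂
  let c₃ := U.pullC g 1 ω₃
  let c₄ := U.pullC g 1 ω₄
  have ha : a ∈ U.Uiso Γ K (Ψ 0) σ := Universe.pullC_mem_Uiso hc _ K (Ψ 0) σ (Theta_sub 0 Γ₁ hω₁)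
  have hb : b ∈ U.Uiso Γ K (Ψ 1) σ := Universe.pullC_mem_Uiso hc _ K (Ψ 1) σ (Theta_sub 1 Γ₁ hω₂)
  have hc₃ : c₃ ∈ U.Uiso Γ K (Ψ 2) σ := Universe.pullC_mem_Uiso hc _ K (Ψ 2) σ (Theta_sub 2 Γ₂ hω₃)
  have hc₄ : c₄ ∈ U.Uiso Γ K (Ψ 3) σ := Universe.pullC_mem_Uiso hc _ K (Ψ 3) σ (Theta_sub 3 Γ₂ hω₄)
  -- the pulled-back wedges are the wedges of the pulled-back one-forms (`Fact_pull_cup`)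
  have e12 : U.pullC f (1 + 1) (U.cup2C (U.pms L ι₁ V Γ₁) 1 ω₁ ω₂) = U.cup2C (U.pms L ι₁ V Γ) 1 a b :=
    Universe.pullC_cup2C hpc f 1 ω₁ ω₂
  have e34 : U.pullC g (1 + 1) (U.cup2C (U.pms L ι₁ V Γ₂) 1 ω₃ ω₄) = U.cup2C (U.pms L ι₁ V Γ) 1 c₃ c₄ :=
    Universe.pullC_cup2C hpc g 1 ω₃ ω₄
  have hinner : ⟪M.emb Γ (U.cup2C _ 1 c₃ c₄), M.emb Γ (U.cup2C _ 1 a b)⟫_ℂ ≠ 0 := by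
    rw [← e12, ← e34]
    exact hfg
  -- Step 4: Petersson = period at level Γ
  obtain ⟨c, hc0, hcΛ⟩ := M.inner_emb Γ
  have hx' : U.cup2C (U.pms L ι₁ V Γ) 1 a b ∈ (U.hodge (U.pms L ι₁ V Γ) (1 + 1)).F (1 + 1) :=
    Universe.cup2C_mem_F_two_of_Uiso hH hcup2 Γ K (Ψ 0) (Ψ 1) σ ha hb
  have hy' : U.cup2C (U.pms L ι₁ V Γ) 1 c₃ c₄ ∈ (U.hodge (U.pms L ι₁ V Γ) (1 + 1)).F (1 + 1) :=
    Universe.cup2C_mem_F_two_of_Uiso hH hcup2 Γ K (Ψ 2) (Ψ 3) σ hc₃ hc₄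
  have hper : U.period (U.pms L ι₁ V Γ) ![a, b, c₃, c₄] ≠ 0 := by
    have h := hcΛ (U.cup2C _ 1 a b) (U.cup2C _ 1 c₃ c₄) hx' hy'
    rw [Universe.period_eq_pairing_wedges]
    simp only [Matrix.cons_val_zero, Matrix.cons_val_one, Matrix.cons_val]
    intro h0
    apply hinner
    rw [h]
    exact mul_eq_zero_of_right c h0
  -- Step 5: multilinear expansion to pure pull-backs
  refine Universe.periodNV_of_period_ne_zero Γ _ (fun i => ?_) hper
  match i with
  | 0 => exact ha
  | 1 => exact hb
  | 2 => exact hc₃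
  | 3 => exact hc₄

/-- The socket's closed-span `coupling` (`FaceThetaDatum.coupling`, `B01/ThetaRealisationSocket.lean`:83, PerL Thm 3.7 +
Lemma 3.5 collapsed) implies the MEETING-coupling consumed by `periodNV_of_meeting` (orthogonal-complement lemma
`exists_inner_ne_zero_of_mem_closure_span`, :47): stated over an arbitrary `emb`. [folklore] -/
theorem couplingMeet_of_coupling {U : Universe} {L : CMField} {ι₁ : L →+* ℂ} {V : HermSpace3 L ι₁}
    {HG : Type} [NormedAddCommGroup HG] [InnerProductSpace ℂ HG] (emb : ∀ Γ : Level V, U.CohC (U.pms L ι₁ V Γ) 2 →ₗ[ℂ] HG)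
    (Theta : Fin 4 → ∀ Γ : Level V, Set (U.CohC (U.pms L ι₁ V Γ) 1))
    (coupling : ∀ (Γ : Level V) (ω₁ ω₂ : U.CohC (U.pms L ι₁ V Γ) 1), ω₁ ∈ Theta 0 Γ → ω₂ ∈ Theta 1 Γ →
      emb Γ (U.cup2C (U.pms L ι₁ V Γ) 1 ω₁ ω₂) ∈ (Submodule.span ℂ
        {x : HG | ∃ (Γ' : Level V), ∃ ω₃ ∈ Theta 2 Γ', ∃ ω₄ ∈ Theta 3 Γ',
          x = emb Γ' (U.cup2C (U.pms L ι₁ V Γ') 1 ω₃ ω₄)}).topologicalClosure)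
    (Γ : Level V) (ω₁ ω₂ : U.CohC (U.pms L ι₁ V Γ) 1) (hω₁ : ω₁ ∈ Theta 0 Γ) (hω₂ : ω₂ ∈ Theta 1 Γ)
    (hv : emb Γ (U.cup2C (U.pms L ι₁ V Γ) 1 ω₁ ω₂) ≠ 0) :
    ∃ (Γ' : Level V), ∃ ω₃ ∈ Theta 2 Γ', ∃ ω₄ ∈ Theta 3 Γ',
      ⟪emb Γ' (U.cup2C (U.pms L ι₁ V Γ') 1 ω₃ ω₄), emb Γ (U.cup2C (U.pms L ι₁ V Γ) 1 ω₁ ω₂)⟫_ℂ ≠ 0 := by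
  obtain ⟨u, ⟨Γ', ω₃, hω₃, ω₄, hω₄, rfl⟩, hu⟩ :=
    exists_inner_ne_zero_of_mem_closure_span (inner_self_ne_zero.mpr hv) (coupling Γ ω₁ ω₂ hω₁ hω₂)
  refine ⟨Γ', ω₃, hω₃, ω₄, hω₄, ?_⟩
  intro h0
  apply hu
  rw [← inner_conj_symm, h0, map_zero]

/-- **Consistency check**: the meeting engine re-derives the socket engine — a socket datum gives `PeriodNV` through
`AutomorphicDictionary.toMeeting` and `couplingMeet_of_coupling` (same four universe facts as
`Universe.periodNV_of_faceThetaDatum`). [folklore] -/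
theorem periodNV_of_faceThetaDatum_via_meeting {U : Universe} (hc : U.Fact_pull_comp) (hH : U.Fact_pull_hodge)
    (hcup2 : U.Fact_cup2_hodge) (hpc : U.Fact_pull_cup) {L : CMField} {ι₁ : L →+* ℂ} {V : HermSpace3 L ι₁} {K : CMField}
    {Ψ : Fin 4 → CMType K} {σ : K →+* ℂ} (R : U.FaceThetaDatum ι₁ V K Ψ σ) : U.PeriodNV ι₁ V K Ψ σ :=
  periodNV_of_meeting hc hH hcup2 hpc (AutomorphicDictionary.ofFaceThetaDatum R).toMeeting R.Theta R.Theta_sub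
    R.lineField (couplingMeet_of_coupling R.emb R.Theta R.coupling)

/-! ## 4. Item (iii) as displayed binders (general scope ⇒ face scope; dictionary ⇒ meeting) -/

/-- **Item (iii), GENERAL SCOPE, socket-verbatim form** (PerL §3.1 «general»: «stated and proved … for the unitary group of a
hermitian 3-space of signature (2,1),(3,0),… over an arbitrary CM field of degree ≥ 4», rfwf v3 tex ll.227–229): every CM
field `L` with `4 ≤ [L:ℚ]`, every `ι₁`, every hermitian 3-space `V` (signature (2,1) at `ι₁`, definite elsewhere — hence
`G_U` anisotropic and `P_Γ` compact) carries an automorphic dictionary.  ∀V (item (iii) is V-uniform).  Displayed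
hypothesis, asserted by no one; its intended inhabitant is a port of stage 1's `Model.embOf`/`Model.coverOf` with an
`emb_cover`-compatible normalisation (see the CAVEAT on `AutomorphicDictionary`). [folklore] -/
@[conjecture]
def AutomorphicDictionaryExists (U : Universe) : Prop :=
  ∀ (L : CMField), 4 ≤ Module.finrank ℚ L → ∀ (ι₁ : L →+* ℂ) (V : HermSpace3 L ι₁),
    Nonempty (AutomorphicDictionary U ι₁ V)

/-- **Item (iii), FACE SCOPE, socket-verbatim form** — exactly the scope of `RealisationExistsFace∃`
(`Universe.FaceThetaDataExists`, `Transposition/Assembly.lean`; stage 1 `HodgeCM.Universe.RealisationExistsFace`,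
`HodgeCM/StubTree/Inputs.lean`:97–100): every Galois CM field `F` with `6 ≤ [F:ℚ]`, every `ι₁`, every `V`.  ∀ι₁ ∀V cost
nothing (item (iii) is ι₁- and V-uniform); the assembly instantiates at its chosen `(ι₁, V)`.  Asserted by no one. [folklore] -/
@[conjecture]
def FaceAutomorphicDictionaryExists (U : Universe) : Prop :=
  ∀ (F : CMField), IsGalois ℚ F → 6 ≤ Module.finrank ℚ F → ∀ (ι₁ : F →+* ℂ) (V : HermSpace3 F ι₁),
    Nonempty (AutomorphicDictionary U ι₁ V)

/-- **Item (iii), GENERAL SCOPE, meeting form** (the form stage 1's E term of record carries: `Model.embOf` +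
`innerEmbAt_of_sides` + level-meeting).  Asserted by no one. [folklore] -/
@[conjecture]
def AutomorphicMeetingExists (U : Universe) : Prop :=
  ∀ (L : CMField), 4 ≤ Module.finrank ℚ L → ∀ (ι₁ : L →+* ℂ) (V : HermSpace3 L ι₁),
    Nonempty (AutomorphicMeeting U ι₁ V)

/-- **Item (iii), FACE SCOPE, meeting form.**  Asserted by no one. [folklore] -/
@[conjecture]
def FaceAutomorphicMeetingExists (U : Universe) : Prop :=
  ∀ (F : CMField), IsGalois ℚ F → 6 ≤ Module.finrank ℚ F → ∀ (ι₁ : F →+* ℂ) (V : HermSpace3 F ι₁),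
    Nonempty (AutomorphicMeeting U ι₁ V)

variable {U : Universe}

/-- General scope ⇒ face scope (socket-verbatim form): `6 ≤ [F:ℚ]` gives `4 ≤ [F:ℚ]`. [folklore] -/
theorem faceAutomorphicDictionaryExists_of_general (h : AutomorphicDictionaryExists U) :
    FaceAutomorphicDictionaryExists U :=
  fun F _ h6 ι₁ V => h F (le_trans (by norm_num) h6) ι₁ V

/-- General scope ⇒ face scope (meeting form). [folklore] -/
theorem faceAutomorphicMeetingExists_of_general (h : AutomorphicMeetingExists U) : FaceAutomorphicMeetingExists U :=
  fun F _ h6 ι₁ V => h F (le_trans (by norm_num) h6) ι₁ V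

/-- Socket-verbatim ⇒ meeting (general scope), by `AutomorphicDictionary.toMeeting`. [folklore] -/
theorem automorphicMeetingExists_of_dictionary (h : AutomorphicDictionaryExists U) : AutomorphicMeetingExists U :=
  fun L h4 ι₁ V => (h L h4 ι₁ V).map AutomorphicDictionary.toMeeting

/-- Socket-verbatim ⇒ meeting (face scope), by `AutomorphicDictionary.toMeeting`. [folklore] -/
theorem faceAutomorphicMeetingExists_of_dictionary (h : FaceAutomorphicDictionaryExists U) :
    FaceAutomorphicMeetingExists U :=
  fun F hG h6 ι₁ V => (h F hG h6 ι₁ V).map AutomorphicDictionary.toMeeting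

end Transposition

end Summit.HodgeConjecture.CorCM

end
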